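import Literature.NumberTheory.EllipticCurves.Kato2004.IwasawaH1LambdaTorsionFreeProofs
import Mathlib.Algebra.Module.LocalizedModule.Basic
import HarnessLib

/-!
# Kato's descent — file 5: the ℚ-SIDE discharge of the "Thm. 12.4 (2)" hypothesis `hz` of the descent
# inequality (`Ann_A(ι(z/1)) ⊆ (a)`), for Kato's pinned `𝐇¹_Γ(T_pW)` — every `E/ℚ`, every `p`

Helper file for crux K2R0P♭ `stmt-BirchSwinnertonDyer-26471`
(`Summit.BirchSwinnertonDyer.BirchSwinnertonDyer.Theses.ThetaPartnerAtTwo.SignedMainConjectureCMTwoRankZeroOfPubOfFlat`,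
route `ThetaPartnerAtTwo`, line `rankzero` v16, lead prover bsd-wall-tp2-p2 g9, 2026-08-28). BSD is not proved
by any of this; no curve- or prime-specific hypothesis enters (the theorems hold for every `E/ℚ`, `p`, `κ`,
topological generator `γ`, datum `I`).

The descent inequality of this series (`KatoDescent.length_quotient_span_le_length_quotSMulTop`, file 3, and its
K-side composition `length_quotient_span_ell_le_length_quotSMulTop(_of_length_ne_top)`, file 4) carries the
hypothesis `hz : ∀ b : A, b • ι(z/1) = 0 → b ∈ (a)` — Kato Thm. 12.4 (2) "`𝐇¹(T~)` is torsion free" read at the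
height-one prime `𝔭` of the cyclotomic algebra, with `A → A/aA ≅ Λ_𝔭` (Lemma 15.13 (1)) acting on
`W = 𝐇¹(T~)_𝔭 = (𝐇¹_Γ(T_pW))_𝔭` and `ι(z/1) = z~ = s/1` the image of Kato's zeta element `s ∈ 𝐇¹_Γ` ((15.13.2),
(15.16.1)). The tree PROVES Thm. 12.4 (2) for the pinned `I : Kato2004.IwasawaH1Data W p κ γ`
(`Kato2004.IwasawaH1Data.isTorsionFree`, file `Kato2004/IwasawaH1LambdaTorsionFreeProofs`). This file turns that
into exactly the shape `hz` needs:
* `iwasawaH1_isTorsionFree_localizedModule` : `(𝐇¹_Γ)_𝔭` is a torsion-free `Λ_𝔭`-module;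
* `iwasawaH1_mkLinearMap_ne_zero` : `s ≠ 0 ⟹ s/1 ≠ 0` in `(𝐇¹_Γ)_𝔭`;
* `mem_span_singleton_of_smul_eq_zero` (generic): for a ring map `φ : A → B` with `ker φ ⊆ (a)`, `B` a domain,
  `W` a torsion-free `B`-module on which `A` acts through `φ`, and `w ≠ 0`: `b • w = 0 ⟹ b ∈ (a)`;
* `iwasawaH1_mem_span_singleton_of_smul_mkLinearMap_eq_zero` : the composite — `hz` holds for
  `W = (𝐇¹_Γ)_𝔭`, `ι(z/1) = s/1`, as soon as `s ≠ 0` in `𝐇¹_Γ` (for the zeta element: Kato §15.15, from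
  `L(f_A, 1) ≠ 0` at analytic rank `0` via Thm. 12.5 (1)) and `ker(A → Λ_𝔭) ⊆ (a)` (15.13 (1)).
So the "12.4 (2)" item of the typed debt of clause (g) is reduced to `s ≠ 0` + the ring datum of 15.13 (1).

## References
* K. Kato, Astérisque 295 (2004), Thm. 12.4 (2) (p. 221), Lemma 15.13 and §15.15 (pp. 264–265).
-/

set_option autoImplicit false
set_option linter.dupNamespace false

noncomputable section

open scoped Classical

namespace Summit.BirchSwinnertonDyer.BirchSwinnertonDyer.Theorems.KatoDescent

open Literature.NumberTheory.EllipticCurves Literature.NumberTheory.EllipticCurves.Kato2004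
  Literature.NumberTheory.GaloisRepresentations Field

/-! ## Generic: annihilators through a ring map with kernel in `(a)` -/

section Generic

/-- **`b • w = 0 ⟹ b ∈ (a)`** when `A` acts on the torsion-free `B`-module `W` (`B` a domain) through a ring
map `φ : A → B` whose kernel lies in `(a)`, and `w ≠ 0`: `φ(b) • w = 0` forces `φ(b) = 0`. The algebraic
content of "Kato Thm. 12.4 (2) kills the defect of the descent" (file 3, `tors_quotient_span_eq_bot`).
[cite: Kato2004Asterisque, Thm. 12.4 (2) (p. 221) and Lemma 15.13 (1) (p. 264)] -/
theorem mem_span_singleton_of_smul_eq_zero {A B W : Type*} [CommRing A] [CommRing B] [IsDomain B]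
    [AddCommGroup W] [Module B W] [Module.IsTorsionFree B W] [Module A W] (φ : A →+* B)
    (hφ : ∀ (b : A) (w : W), b • w = φ b • w) {a : A} (hker : ∀ b : A, φ b = 0 → b ∈ Ideal.span {a})
    {w : W} (hw : w ≠ 0) (b : A) (hb : b • w = 0) : b ∈ Ideal.span {a} :=
  hker b ((smul_eq_zero_iff_left hw).mp (by rw [← hφ]; exact hb))

end Generic

/-! ## The pinned `𝐇¹_Γ(T_pW)`: its localisations are torsion free -/

section QSide

variable {p : ℕ} [Fact p.Prime] {W : WeierstrassCurve ℚ} [W.IsElliptic] [ContinuousSMul ℤ_[p] (W.tateModule p)]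
  {κ : ZpExtension ℚ p} {γ : absoluteGaloisGroup ℚ}

/-- **`(𝐇¹_Γ(T_pW))_𝔭` is a torsion-free `Λ_𝔭`-module** at every prime `𝔭` of `Λ = ℤ_p⟦T⟧` — Kato Thm. 12.4 (2)
(tree theorem `IwasawaH1Data.isTorsionFree`) localised (`Λ` is a domain; Mathlib). [cite: Kato2004Asterisque, Thm. 12.4 (2) (p. 221)] -/
theorem iwasawaH1_isTorsionFree_localizedModule (hγ : κ.IsTopGenerator γ) (I : IwasawaH1Data W p κ γ)
    (𝔭 : PrimeSpectrum (IwasawaAlgebra p)) :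
    Module.IsTorsionFree (Localization.AtPrime 𝔭.asIdeal) (LocalizedModule 𝔭.asIdeal.primeCompl I.H) := by
  haveI := I.isTorsionFree hγ
  infer_instance

/-- **`s ≠ 0 ⟹ s/1 ≠ 0` in `(𝐇¹_Γ)_𝔭`** (the localisation map of a torsion-free module over a domain is
injective: `s/1 = 0` iff `u • s = 0` for some `u ∉ 𝔭`, and `u ≠ 0`). [cite: Kato2004Asterisque, Thm. 12.4 (2) (p. 221)] -/
theorem iwasawaH1_mkLinearMap_ne_zero (hγ : κ.IsTopGenerator γ) (I : IwasawaH1Data W p κ γ)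
    (𝔭 : PrimeSpectrum (IwasawaAlgebra p)) {s : I.H} (hs : s ≠ 0) :
    LocalizedModule.mkLinearMap 𝔭.asIdeal.primeCompl I.H s ≠ 0 := by
  haveI := I.isTorsionFree hγ
  intro h0
  rw [LocalizedModule.mkLinearMap_apply, ← LocalizedModule.zero_mk 1, LocalizedModule.mk_eq] at h0
  obtain ⟨u, hu⟩ := h0
  simp only [smul_zero, one_smul] at hu
  have hu0 : (u : IwasawaAlgebra p) ≠ 0 := fun h ↦
    (show (0 : IwasawaAlgebra p) ∉ 𝔭.asIdeal.primeCompl from fun h' ↦ h' 𝔭.asIdeal.zero_mem) (h ▸ u.2)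
  rw [Submonoid.smul_def] at hu
  exact hs ((smul_eq_zero_iff_right hu0).mp hu)

/-- **The hypothesis `hz` of the descent inequality, discharged on the ℚ-side**: for every ring `A` acting on
`W = (𝐇¹_Γ(T_pW))_𝔭` through a ring map `φ : A → Λ_𝔭` with `ker φ ⊆ (a)` (Kato 15.13 (1): `A = O_λ⟦G_{p^∞𝔣}⟧_𝔮`,
`(a)` the kernel of `A → O_λ⟦G_∞⟧_𝔭`) and every `s ∈ 𝐇¹_Γ` with `s ≠ 0` (Kato §15.15 for the zeta element):
`b • (s/1) = 0 ⟹ b ∈ (a)`. [cite: Kato2004Asterisque, Thm. 12.4 (2) (p. 221), Lemma 15.13 (1) (p. 264), §15.15 (p. 265)] -/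
theorem iwasawaH1_mem_span_singleton_of_smul_mkLinearMap_eq_zero (hγ : κ.IsTopGenerator γ)
    (I : IwasawaH1Data W p κ γ) (𝔭 : PrimeSpectrum (IwasawaAlgebra p))
    {A : Type*} [CommRing A] (φ : A →+* Localization.AtPrime 𝔭.asIdeal)
    [Module A (LocalizedModule 𝔭.asIdeal.primeCompl I.H)]
    (hφ : ∀ (b : A) (w : LocalizedModule 𝔭.asIdeal.primeCompl I.H), b • w = φ b • w)
    {a : A} (hker : ∀ b : A, φ b = 0 → b ∈ Ideal.span {a}) {s : I.H} (hs : s ≠ 0) (b : A)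
    (hb : b • LocalizedModule.mkLinearMap 𝔭.asIdeal.primeCompl I.H s = 0) : b ∈ Ideal.span {a} := by
  haveI := iwasawaH1_isTorsionFree_localizedModule hγ I 𝔭
  exact mem_span_singleton_of_smul_eq_zero φ hφ hker (iwasawaH1_mkLinearMap_ne_zero hγ I 𝔭 hs) b hb

end QSide

/-! ## Adapters (appended, lead g9): the left-hand side of the descent conclusion IS `ℓ_𝔭(M/R·x)` -/

section Adapters

open Literature.NumberTheory.EllipticCurves.Module

variable {R : Type*} [CommRing R]

/-- **`ℓ_𝔭(M/R·x) = ℓ_{R_𝔭}(M_𝔭/R_𝔭·(x/1))`**: localisation commutes with the quotient by a cyclic submodule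
(Mathlib `localizedQuotientEquiv`, `Submodule.localized'_span`). With `R = Λ`, `M = 𝐇¹_Γ(T₂A)`, `x = s` this turns the
tree's `lengthAt Λ (I.H ⧸ Λ∙s) 𝔭` (clause (g)^ι) into the `W ⧸ span {s/1}` of the descent inequality. [folklore] -/
theorem lengthAt_quotient_span_singleton_eq_length_localized {M : Type*} [AddCommGroup M] [Module R M]
    (x : M) (𝔭 : PrimeSpectrum R) :
    lengthAt R (M ⧸ Submodule.span R {x}) 𝔭 =
      Module.length (Localization.AtPrime 𝔭.asIdeal)
        (LocalizedModule 𝔭.asIdeal.primeCompl M ⧸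
          Submodule.span (Localization.AtPrime 𝔭.asIdeal)
            {LocalizedModule.mkLinearMap 𝔭.asIdeal.primeCompl M x}) := by
  unfold lengthAt
  have hspan : Submodule.localized 𝔭.asIdeal.primeCompl (Submodule.span R {x}) =
      Submodule.span (Localization.AtPrime 𝔭.asIdeal)
        {LocalizedModule.mkLinearMap 𝔭.asIdeal.primeCompl M x} := by
    rw [Submodule.localized, Submodule.localized'_span, Set.image_singleton]
  exact ((localizedQuotientEquiv 𝔭.asIdeal.primeCompl (Submodule.span R {x})).symm ≪≫ₗ
    Submodule.quotEquivOfEq _ _ hspan).length_eq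

/-- **Change of rings along a surjection for `ℓ(W/⟨w⟩)`**: if `A` acts on the `B`-module `W` through a SURJECTIVE ring
map `φ : A → B` (`b • w = φ b • w`), then `A∙w` and `B∙w` are the same subgroup and `ℓ_A(W/A∙w) = ℓ_B(W/B∙w)`. With
`A = O_λ⟦G_{p^∞𝔣}⟧_𝔮 → B = Λ_𝔭 = A/aA` (Kato 15.13 (1)) this turns the conclusion `ℓ_A(W/A·ι z)` of the descent
inequality into `ℓ_{Λ_𝔭}(W/Λ_𝔭·(s/1))`, i.e. (previous lemma) into `ℓ_𝔭(𝐇¹_Γ/Λ s)`.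
[cite: Kato2004Asterisque, Lemma 15.13 (1) (p. 264)] -/
theorem length_quotient_span_singleton_eq_of_surjective {A B W : Type*} [CommRing A] [CommRing B]
    [AddCommGroup W] [Module B W] [Module A W] (φ : A →+* B) (hφ : Function.Surjective φ)
    (hφW : ∀ (b : A) (w : W), b • w = φ b • w) (w : W) :
    Module.length A (W ⧸ Submodule.span A {w}) = Module.length B (W ⧸ Submodule.span B {w}) := by
  letI : Algebra A B := φ.toAlgebra
  haveI : IsScalarTower A B W := ⟨fun a b x ↦ by
    change (φ a * b) • x = a • (b • x)
    rw [hφW, mul_smul]⟩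
  -- the two spans coincide as additive subgroups
  have hset : (Submodule.span A {w} : Set W) = (Submodule.span B {w} : Set W) := by
    ext y
    simp only [SetLike.mem_coe, Submodule.mem_span_singleton]
    constructor
    · rintro ⟨b, rfl⟩
      exact ⟨φ b, (hφW b w).symm⟩
    · rintro ⟨c, rfl⟩
      obtain ⟨b, rfl⟩ := hφ c
      exact ⟨b, hφW b w⟩
  have hres : (Submodule.span B {w}).restrictScalars A = Submodule.span A {w} :=
    SetLike.coe_injective (by rw [Submodule.coe_restrictScalars, hset])
  -- `W/B∙w` as an `A`-module through `φ` is `W/A∙w`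
  have h1 : Module.length A (W ⧸ Submodule.span B {w}) = Module.length B (W ⧸ Submodule.span B {w}) :=
    Module.length_eq_of_surjective (S := A) (R := B) (M := W ⧸ Submodule.span B {w})
      (by rwa [RingHom.algebraMap_toAlgebra])
  rw [← h1]
  exact ((Submodule.quotEquivOfEq _ _ hres.symm) ≪≫ₗ
    (Submodule.Quotient.restrictScalarsEquiv A (Submodule.span B {w}))).length_eq

end Adapters

end Summit.BirchSwinnertonDyer.BirchSwinnertonDyer.Theorems.KatoDescent

end
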